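import Mathlib
import Literature.NumberTheory.Transcendental.ZagierDilogarithmConjecture
import Literature.NumberTheory.Transcendental.BlochWignerDilogarithmProofs
import Summits.KontsevichZagierPeriods.KontsevichZagierPeriods.Theorems.HyperbolicBlochZagierDilogarithmConjectureStubTwistMemClosure
import Summits.KontsevichZagierPeriods.KontsevichZagierPeriods.Theorems.HyperbolicBlochZagierDilogarithmConjectureStubKummerDescent
import Summits.KontsevichZagierPeriods.KontsevichZagierPeriods.Theorems.HyperbolicBlochZagierDilogarithmConjectureStubCyclotomicPoints
import HarnessLib

/-!
# `ZagierDilogarithmConjecture` (stmt-KontsevichZagierPeriods-10550) — line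
`kummer-clausen-linearisation` (reshape c4, "the cyclotomic sector, exactly"), stub
`stub_cyclotomicTwists`

**Galois-twisted Clausen sums of explained cyclotomic combinations vanish.** Let `ζ_N = exp(2πi/N)`
(`N ≥ 1`), `D = blochWignerDilog` the Bloch–Wigner dilogarithm and
`C = ⟨dilogRelators⟩ ⊆ ℤ[ℂ]` the relator group (five-term relators at algebraic points, conjugation
pairs `[w] + [w̄]`, real points `[w]`). If `β = Σ_{c mod N} m_c [ζ_N^c] ∈ C` then for every unit
`a mod N`

`Σ_{c mod N} m_c · D(ζ_N^{ac}) = 0`.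

Proof.
* `ζ_N` is a primitive `N`-th root of unity, algebraic, so it lifts to
  `Z ∈ ℚ̄ = algebraicClosure ℚ ℂ`, again a primitive `N`-th root; `ζ_N^a` is a primitive `N`-th root
  as well (`a` is a unit), so `Z` and `ζ_N^a` have the same minimal polynomial over `ℚ` (the
  cyclotomic polynomial,
  `IsPrimitiveRoot.minpoly_eq_cyclotomic_of_irreducible`). Every minimal polynomial splits in `ℂ`,
  hence there is a `ℚ`-embedding `σ : ℚ̄ → ℂ` with `σ Z = ζ_N^a`
  (`IntermediateField.exists_algHom_of_splits_of_aeval`)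
  — `exists_algHom_apply_eq`.
* EXACTNESS of the Galois twist (`stub_twist_mem_closure`, tree): with the lifts `w_c = Z^c` of
  `ζ_N^c` and `w'_c = Z^{(N-1)c}` of `conj (ζ_N^c) = ζ_N^{(N-1)c}`,
  `Σ_c m_c ([σ w_c] − [σ w'_c]) = Σ_c m_c ([ζ_N^{ac}] − [conj ζ_N^{ac}]) ∈ C`.
* SOUNDNESS (`lift_eq_zero_of_mem_closure`, tree): the value map `[w] ↦ D(w)` kills `C`, and
  `D(w̄) = −D(w)` (`blochWignerDilog_conj'`), so `2 Σ_c m_c D(ζ_N^{ac}) = 0`.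
* Finally `ζ_N^{a.val · c.val} = ζ_N^{(a c).val}` as `ζ_N^N = 1` (`ZMod.val_mul`, `pow_eq_pow_mod`).
Mathlib + the tree's Galois-descent / Kummer-descent files only; sorry-free;
axioms ⊆ {propext, Classical.choice, Quot.sound}.

## References

* W. D. Neumann, *Hilbert's 3rd problem and invariants of 3-manifolds*, Geom. Topol. Monogr. 1
  (1998), §2.1 (the relator group, `D(z̄) = −D(z)`, Galois action on the Bloch group). [Neumann1998]
* D. Zagier, *The dilogarithm function*, in: Frontiers in Number Theory, Physics, and Geometry II
  (2007), Ch. I §§3–4. [Zagier2007Dilogarithm]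
-/

noncomputable section

open scoped BigOperators ComplexConjugate
open Literature.NumberTheory.Transcendental

namespace Summit.KontsevichZagierPeriods.HyperbolicBloch.ZagierDilogarithmCyclotomic

open Summit.KontsevichZagierPeriods.HyperbolicBloch.ZagierDilogarithm (lift_eq_zero_of_mem_closure)
open Summit.KontsevichZagierPeriods.HyperbolicBloch.ZagierDilogarithmGaloisDescent
  (stub_twist_mem_closure cyclo_conj_eq_pow)

/-! ### Galois: moving one primitive root of unity to another -/

/-- **Transitivity of `ℚ`-embeddings on primitive roots of unity.** For a primitive `N`-th root of
unity `Z ∈ ℚ̄ = algebraicClosure ℚ ℂ` and any primitive `N`-th root of unity `μ ∈ ℂ` there is a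
`ℚ`-algebra map `σ : ℚ̄ → ℂ` with `σ Z = μ`: both have the cyclotomic polynomial as minimal
polynomial over `ℚ`, and every minimal polynomial of an element of the algebraic extension `ℚ̄/ℚ`
splits in `ℂ`. [folklore] -/
theorem exists_algHom_apply_eq {N : ℕ} (hN : 0 < N) {Z : ↥(algebraicClosure ℚ ℂ)}
    (hZ : IsPrimitiveRoot Z N) {μ : ℂ} (hμ : IsPrimitiveRoot μ N) :
    ∃ σ : ↥(algebraicClosure ℚ ℂ) →ₐ[ℚ] ℂ, σ Z = μ := by
  haveI : NeZero N := ⟨hN.ne'⟩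
  haveI : Algebra.IsAlgebraic ℚ ↥(algebraicClosure ℚ ℂ) := algebraicClosure.isAlgebraic ℚ ℂ
  refine IntermediateField.exists_algHom_of_splits_of_aeval
    (fun s => ⟨(Algebra.IsAlgebraic.isAlgebraic s).isIntegral, IsAlgClosed.splits _⟩) ?_
  rw [← hZ.minpoly_eq_cyclotomic_of_irreducible (Polynomial.cyclotomic.irreducible_rat hN),
    hμ.minpoly_eq_cyclotomic_of_irreducible (Polynomial.cyclotomic.irreducible_rat hN)]
  exact minpoly.aeval ℚ μ

/-! ### The exactness theorem, reindexed -/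

/-- `stub_twist_mem_closure` (explained combinations stay explained under every Galois twist) for
families indexed by an arbitrary finite type (reindex along `Fintype.equivFin`). [folklore] -/
theorem twist_mem_closure_fintype {ι : Type*} [Fintype ι] (z : ι → ℂ) (n : ι → ℤ)
    (hβ : (∑ i, n i • FreeAbelianGroup.of (z i)) ∈ AddSubgroup.closure dilogRelators)
    (σ : ↥(algebraicClosure ℚ ℂ) →ₐ[ℚ] ℂ) (w w' : ι → ↥(algebraicClosure ℚ ℂ))
    (hw : ∀ i, (w i : ℂ) = z i) (hw' : ∀ i, (w' i : ℂ) = conj (z i)) :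
    (∑ i, n i • (FreeAbelianGroup.of (σ (w i)) - FreeAbelianGroup.of (σ (w' i)))) ∈
      AddSubgroup.closure dilogRelators := by
  classical
  rw [← (Fintype.equivFin ι).symm.sum_comp] at hβ ⊢
  exact stub_twist_mem_closure _ (z ∘ (Fintype.equivFin ι).symm) (n ∘ (Fintype.equivFin ι).symm)
    hβ σ (w ∘ (Fintype.equivFin ι).symm) (w' ∘ (Fintype.equivFin ι).symm) (fun _ => hw _)
    (fun _ => hw' _)

/-! ### The stub -/

/-- **Stub `stub_cyclotomicTwists` (Galois-twisted Clausen sums of explained cyclotomic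
combinations vanish).** For `ζ_N = exp(2πi/N)` and `β = Σ_{c mod N} m_c [ζ_N^c] ∈ ⟨dilogRelators⟩`,
every unit `a mod N` has `Σ_c m_c D(ζ_N^{ac}) = 0`: a `ℚ`-embedding `σ : ℚ̄ → ℂ` moves `ζ_N` to
`ζ_N^a` (`exists_algHom_apply_eq`); the twist `Σ_c m_c([ζ_N^{ac}] − [conj ζ_N^{ac}])` of `β` stays
in the relator group (`stub_twist_mem_closure`), on which the value map `[w] ↦ D(w)` vanishes
(`lift_eq_zero_of_mem_closure`), and `D(w̄) = −D(w)`. [cite: Neumann1998, §2.1] -/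
theorem stub_cyclotomicTwists :
    ∀ (N : ℕ) [NeZero N] (m : ZMod N → ℤ),
      (∑ c : ZMod N, m c • FreeAbelianGroup.of (Complex.exp (2 * Real.pi * Complex.I / N) ^ c.val)) ∈
          AddSubgroup.closure dilogRelators →
        ∀ a : (ZMod N)ˣ, ∑ c : ZMod N, (m c : ℝ) *
          blochWignerDilog (Complex.exp (2 * Real.pi * Complex.I / N) ^ ((a : ZMod N) * c).val) = 0 := by
  intro N _ m hβ a
  have hN : 0 < N := Nat.pos_of_ne_zero (NeZero.ne N)
  -- `ζ = exp (2πi/N)` is a primitive `N`-th root of unity; abstract it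
  have hζ : IsPrimitiveRoot (Complex.exp (2 * Real.pi * Complex.I / N)) N :=
    Complex.isPrimitiveRoot_exp N hN.ne'
  generalize Complex.exp (2 * Real.pi * Complex.I / N) = ζ at hβ hζ
  -- the exponents: `ζ ^ (a c).val = ζ ^ (a.val * c.val)`
  have hexp : ∀ c : ZMod N, ζ ^ ((a : ZMod N) * c).val = ζ ^ ((a : ZMod N).val * c.val) :=
    fun c => by rw [ZMod.val_mul, ← pow_eq_pow_mod _ hζ.pow_eq_one]
  simp_rw [hexp]
  -- `ζ` is algebraic; its lift `Z ∈ ℚ̄` is a primitive `N`-th root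
  have hζa : IsAlgebraic ℚ ζ := by
    refine ⟨Polynomial.X ^ N - Polynomial.C 1, Polynomial.X_pow_sub_C_ne_zero hN 1, ?_⟩
    simp [hζ.pow_eq_one]
  obtain ⟨Z, hZ⟩ : ∃ Z : ↥(algebraicClosure ℚ ℂ), (Z : ℂ) = ζ :=
    ⟨⟨ζ, mem_algebraicClosure_iff.2 hζa⟩, rfl⟩
  have hZp : IsPrimitiveRoot Z N := by
    refine IsPrimitiveRoot.of_map_of_injective (f := (algebraicClosure ℚ ℂ).val) ?_
      (algebraicClosure ℚ ℂ).val.toRingHom.injective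
    show IsPrimitiveRoot (Z : ℂ) N
    rw [hZ]
    exact hζ
  -- `ζ ^ a` is a primitive `N`-th root; a `ℚ`-embedding `σ : ℚ̄ → ℂ` with `σ Z = ζ ^ a`
  set j : ℕ := (a : ZMod N).val with hj
  have hζj : IsPrimitiveRoot (ζ ^ j) N := hζ.pow_of_coprime j (ZMod.val_coe_unit_coprime a)
  obtain ⟨σ, hσ⟩ := exists_algHom_apply_eq hN hZp hζj
  -- the lifts of `ζ ^ c` and `conj (ζ ^ c) = ζ ^ ((N - 1) c)`
  have hw : ∀ c : ZMod N, ((Z ^ c.val : ↥(algebraicClosure ℚ ℂ)) : ℂ) = ζ ^ c.val := fun c => by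
    push_cast
    rw [hZ]
  have hw' : ∀ c : ZMod N,
      ((Z ^ ((N - 1) * c.val) : ↥(algebraicClosure ℚ ℂ)) : ℂ) = conj (ζ ^ c.val) := fun c => by
    push_cast
    rw [hZ, map_pow, cyclo_conj_eq_pow hζ hN, ← pow_mul]
  -- exactness: the twisted conjugation-odd double of `β` is explained
  have hT := twist_mem_closure_fintype (fun c : ZMod N => ζ ^ c.val) m hβ σ (fun c => Z ^ c.val)
    (fun c => Z ^ ((N - 1) * c.val)) hw hw'
  -- soundness: its `D`-value vanishes, and it is twice the twisted Clausen sum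
  have h0 := lift_eq_zero_of_mem_closure hT
  have hconj : ∀ c : ZMod N, (ζ ^ j) ^ ((N - 1) * c.val) = conj ((ζ ^ j) ^ c.val) := fun c => by
    rw [map_pow, cyclo_conj_eq_pow hζj hN, ← pow_mul (ζ ^ j) (N - 1)]
  have hterm : ∀ c : ZMod N, FreeAbelianGroup.lift blochWignerDilog
      (m c • (FreeAbelianGroup.of (σ (Z ^ c.val)) -
        FreeAbelianGroup.of (σ (Z ^ ((N - 1) * c.val))))) =
      2 * ((m c : ℝ) * blochWignerDilog (ζ ^ (j * c.val))) := fun c => by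
    rw [map_zsmul, map_sub, FreeAbelianGroup.lift_apply_of, FreeAbelianGroup.lift_apply_of, map_pow,
      map_pow, hσ, hconj, blochWignerDilog_conj', ← pow_mul, zsmul_eq_mul]
    ring
  rw [map_sum, Finset.sum_congr rfl fun c _ => hterm c, ← Finset.mul_sum] at h0
  exact (mul_eq_zero.1 h0).resolve_left two_ne_zero

end Summit.KontsevichZagierPeriods.HyperbolicBloch.ZagierDilogarithmCyclotomic

end
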